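import Mathlib
import Literature.NumberTheory.Automorphic.HilbertModularFormQExpansion

/-!
# The `E`-rational encoded `q`-expansions form a graded multiplicative family with unit (stub Q2)

Stub Q2 `stub_rationalFamily_axioms` of line Sketch-ideate-r1-k1 (section Q, the `p`-adic graded
family of the algebraization-engine instance) for the crux `HilbertIntegralOverconvergentIsCongruence`
(stmt-Langlands-8485).  Given an encoding `enc` of `q`-expansions of Hilbert modular forms of level
`Γ₁(𝔫)` into `ℂ⟦X_1, …, X_d⟧` which is multiplicative on forms and sends the unit form `1_ℍ` (a form
of weight `0`) to `1`, a number field `E` with a complex embedding `τ` and a `p`-adic embedding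
`v : E → ℚ̄_p` (`ℚ̄_p = PadicAlgCl p`, Mathlib's algebraic closure of `ℚ_p`), consider the family
`S b := {map v A | A ∈ E⟦X⟧, map τ A = enc f for some f ∈ M_b(Γ₁(𝔫))}`.  We show `1 ∈ S 0`
(witness `A = 1`, `f = 1_ℍ`) and `S b₁ · S b₂ ⊆ S (b₁ + b₂)` (witness `A · B`, `f · g`, using that
`MvPowerSeries.map` is a ring homomorphism and `mul_mem_modularForms`).
-/

set_option linter.dupNamespace false

noncomputable section

namespace Summit.Langlands.Langlands.Theorems.HilbertIntegralOverconvergentIsCongruence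

open MeasureTheory Complex NumberField
open Literature.NumberTheory.Automorphic Literature.NumberTheory.Automorphic.HilbertModular

/-- **Stub Q2.** For an encoding `enc` of `q`-expansions which is multiplicative on Hilbert modular
forms of level `Γ₁(𝔫)` and sends the unit form `1_ℍ` to `1`, the `v`-images of the `E`-rational
encoded `q`-expansions (`A` over `E` with `map τ A = enc f`, `f ∈ M_b(Γ₁(𝔫))`) contain `1` in
weight `0` and are closed under graded products. -/
theorem stub_rationalFamily_axioms (F : Type) [Field F] [NumberField F] (𝔫 : Ideal (𝓞 F)) (d : ℕ)
    (enc : (Point F → ℂ) → MvPowerSeries (Fin d) ℂ)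
    (hmul : ∀ (k k' : (F →+* ℝ) → ℤ) (f g : Point F → ℂ), f ∈ modularForms (Bianchi.Gamma1 𝔫) k →
      g ∈ modularForms (Bianchi.Gamma1 𝔫) k' → enc (f * g) = enc f * enc g)
    (hone : (halfSpace F).indicator (fun _ ↦ (1 : ℂ)) ∈ modularForms (Bianchi.Gamma1 𝔫) 0 ∧
      enc ((halfSpace F).indicator (fun _ ↦ (1 : ℂ))) = 1)
    (E : Type) [Field E] [NumberField E] (τ : E →+* ℂ) (p : ℕ) [Fact p.Prime] (v : E →+* PadicAlgCl p) :
    (∃ (A : MvPowerSeries (Fin d) E) (f : Point F → ℂ), f ∈ modularForms (Bianchi.Gamma1 𝔫) 0 ∧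
        MvPowerSeries.map τ A = enc f ∧ (1 : MvPowerSeries (Fin d) (PadicAlgCl p)) = MvPowerSeries.map v A) ∧
      ∀ (b₁ b₂ : (F →+* ℝ) → ℤ) (x y : MvPowerSeries (Fin d) (PadicAlgCl p)),
        (∃ (A : MvPowerSeries (Fin d) E) (f : Point F → ℂ), f ∈ modularForms (Bianchi.Gamma1 𝔫) b₁ ∧
          MvPowerSeries.map τ A = enc f ∧ x = MvPowerSeries.map v A) →
        (∃ (A : MvPowerSeries (Fin d) E) (f : Point F → ℂ), f ∈ modularForms (Bianchi.Gamma1 𝔫) b₂ ∧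
          MvPowerSeries.map τ A = enc f ∧ y = MvPowerSeries.map v A) →
        ∃ (A : MvPowerSeries (Fin d) E) (f : Point F → ℂ), f ∈ modularForms (Bianchi.Gamma1 𝔫) (b₁ + b₂) ∧
          MvPowerSeries.map τ A = enc f ∧ x * y = MvPowerSeries.map v A := by
  refine ⟨⟨1, (halfSpace F).indicator (fun _ ↦ (1 : ℂ)), hone.1, ?_, (map_one _).symm⟩, ?_⟩
  · rw [map_one, hone.2]
  · rintro b₁ b₂ x y ⟨A, f, hf, hA, rfl⟩ ⟨B, g, hg, hB, rfl⟩
    refine ⟨A * B, f * g, mul_mem_modularForms hf hg, ?_, (map_mul _ _ _).symm⟩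
    rw [map_mul, hA, hB, hmul b₁ b₂ f g hf hg]

end Summit.Langlands.Langlands.Theorems.HilbertIntegralOverconvergentIsCongruence
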